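import Summits.ABC.ABC.Theorems.IsogenyGlueCongruenceEllipticGluingPrimeBoundStubCMTorsionCoreOfAux1
import Summits.ABC.ABC.Theorems.IsogenyGlueCongruenceEllipticGluingPrimeBoundStubCMTorsionCoreOfAux3
import Summits.ABC.ABC.Theorems.IsogenyGlueCongruenceEllipticGluingPrimeBoundStubCMTorsionCoreOfAux4
import HarnessLib

/-!
# CM torsion core, helpers 5/8: the `θ`-count and the dichotomy

Helper file (5/8) for stub `stub_CMTorsionCoreOf` ((K†), the CM torsion core) of line
`Sketch` (isotypic–Minkowski reduction) of crux U
`Summit.ABC.ABC.Theses.IsogenyGlueCongruence.EllipticGluingPrimeBound` (stmt-ABC-13919); the stub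
itself is proved in `…EllipticGluingPrimeBoundStubCMTorsionCoreOf`.

* `CMTorsion.le_of_eigen_character` — the `θ`-count: a character `ϑ = ψ_+/ψ_-` of `ker χ` with
  finitely many values and an eigenvector for integer matrices of finite order prime to `ℓ`,
  attaining all `((a + d)/(a - d))^{12}`, forces `ℓ ≤ 24 r² + 1` (its image is cyclic of order `N`,
  `ℓ ∤ N`, `φ(N) ≤ r` by `totient_orderOf_le`, `ℓ ≤ 12 N + 1` by `prime_le_of_forall_pow_eq`,
  `N ≤ 2 φ(N)²`);
* `fixed_or_le` (registered sub-goal) — the dichotomy of the CM torsion core: an injective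
  `ker χ`-equivariant `j : V → V^r` on the FACT-2 plane yields a non-zero vector of `𝔽_ℓ^r` fixed
  by all `c̄(σ)`, `σ ∈ ker χ`, or `ℓ ≤ 24 r² + 1`.

Everything is proved; no `def`, no named fact.
-/

noncomputable section

-- `Summit.<Summit>.<Problem>` is the mandated summit-side namespace (CONVENTIONS §2); for the
-- single-conjunct summit `ABC` the two coincide, so the duplicate `ABC.ABC` is deliberate.
set_option linter.dupNamespace false

namespace Summit.ABC.ABC.Theorems.IsotypicMinkowski

open scoped AddSubgroup Matrix

open Literature.AlgebraicGeometry.Motives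

/-! ## The count -/


namespace CMTorsion

/-- **The `θ`-count.** Let `ψ_± : ker χ → 𝔽̄_ℓˣ` be characters with finitely many values,
`ϑ = ψ_+/ψ_-`, and `y ≠ 0` with `c(σ) y = ϑ(σ) y` for integer matrices `c(σ) ∈ M_r(ℤ)` with
`c(σ)^m = 1`, `ℓ ∤ m`; if `ψ_±(σ) = (a ± b d)^{12}` (`d² = D`) is attained for all units `a + b√D`,
then `ℓ ≤ 24 r² + 1`. The image `U` of `ϑ` is a finite subgroup of `𝔽̄_ℓˣ`, of order `N` prime to
`ℓ` (no element of order `ℓ`), cyclic with a generator `ζ = ϑ(σ₀)`; `φ(N) ≤ r`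
(`totient_orderOf_le`), `ℓ ≤ 12 N + 1` (`prime_le_of_forall_pow_eq`, as `((a+d)/(a-d))^{12N} = 1`),
and `N ≤ 2 φ(N)²`. [folklore] -/
theorem le_of_eigen_character {Γ : Type} [Group Γ] {ℓ : ℕ} [Fact ℓ.Prime] (h3 : 3 < ℓ)
    (χ : Γ →* ℤˣ) {D : ZMod ℓ} (hD : D ≠ 0) {r : ℕ} (c : Γ → Matrix (Fin r) (Fin r) ℤ)
    (hcm : ∃ m : ℕ, 0 < m ∧ ¬ ℓ ∣ m ∧ ∀ σ, c σ ^ m = 1)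
    (d : AlgebraicClosure (ZMod ℓ)) (ψp ψm : Γ → AlgebraicClosure (ZMod ℓ))
    (y : Fin r → AlgebraicClosure (ZMod ℓ)) (hd : d ^ 2 = algebraMap (ZMod ℓ) (AlgebraicClosure
        (ZMod ℓ)) D)
    (hy : y ≠ 0) (hψ0 : ∀ σ, χ σ = 1 → ψp σ ≠ 0 ∧ ψm σ ≠ 0)
    (heig : ∀ σ, χ σ = 1 → ψm σ • (((c σ).map (Int.castRingHom (AlgebraicClosure (ZMod ℓ)))) *ᵥ y)
        = ψp σ • y)
    (hmul : ∀ σ τ, χ σ = 1 → χ τ = 1 → ψp (σ * τ) = ψp σ * ψp τ ∧ ψm (σ * τ) = ψm σ * ψm τ)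
    (hfinp : (Set.range ψp).Finite) (hfinm : (Set.range ψm).Finite)
    (hcartan : ∀ a b : ZMod ℓ, a ^ 2 - D * b ^ 2 ≠ 0 → ∃ σ : Γ, χ σ = 1 ∧
      ψp σ = (algebraMap (ZMod ℓ) (AlgebraicClosure (ZMod ℓ)) a +
        algebraMap (ZMod ℓ) (AlgebraicClosure (ZMod ℓ)) b * d) ^ 12 ∧
      ψm σ = (algebraMap (ZMod ℓ) (AlgebraicClosure (ZMod ℓ)) a -
        algebraMap (ZMod ℓ) (AlgebraicClosure (ZMod ℓ)) b * d) ^ 12) :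
    ℓ ≤ 24 * r ^ 2 + 1 := by
  classical
  have hprime : ℓ.Prime := Fact.out
  set ι := algebraMap (ZMod ℓ) (AlgebraicClosure (ZMod ℓ)) with hι
  haveI : CharP (AlgebraicClosure (ZMod ℓ)) ℓ := charP_of_injective_algebraMap ι.injective ℓ
  obtain ⟨m, hm0, hℓm, hcm⟩ := hcm
  have hmF : (m : AlgebraicClosure (ZMod ℓ)) ≠ 0 := fun h ↦ hℓm
    ((CharP.cast_eq_zero_iff (AlgebraicClosure (ZMod ℓ)) ℓ m).1 h)
  -- the character `ϑ = ψp / ψm` on `Γ_K = ker χ`, with values in `F̄ˣ`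
  have hker : ∀ σ : χ.ker, χ (σ : Γ) = 1 := fun σ ↦ MonoidHom.mem_ker.1 σ.2
  let ϑ : χ.ker →* (AlgebraicClosure (ZMod ℓ))ˣ := MonoidHom.mk'
    (fun σ ↦ Units.mk0 (ψp σ * (ψm σ)⁻¹)
      (mul_ne_zero (hψ0 σ (hker σ)).1 (inv_ne_zero (hψ0 σ (hker σ)).2)))
    (fun σ τ ↦ by
      apply Units.ext
      simp only [Units.val_mk0, Units.val_mul, Subgroup.coe_mul]
      rw [(hmul σ τ (hker σ) (hker τ)).1, (hmul σ τ (hker σ) (hker τ)).2, mul_inv]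
      ring)
  have hϑ : ∀ σ : χ.ker, ((ϑ σ : (AlgebraicClosure (ZMod ℓ))ˣ) : AlgebraicClosure (ZMod ℓ)) =
      ψp σ * (ψm σ)⁻¹ := fun _ ↦ rfl
  let U : Subgroup (AlgebraicClosure (ZMod ℓ))ˣ := ϑ.range
  -- `U` is finite, of order prime to `ℓ`, cyclic
  have hUfin : (U : Set (AlgebraicClosure (ZMod ℓ))ˣ).Finite := by
    have hT : ((fun p : AlgebraicClosure (ZMod ℓ) × AlgebraicClosure (ZMod ℓ) ↦ p.1 * p.2⁻¹) ''
        (Set.range ψp ×ˢ Set.range ψm)).Finite := (hfinp.prod hfinm).image _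
    refine (hT.preimage Units.val_injective.injOn).subset ?_
    rintro u ⟨σ, rfl⟩
    exact ⟨(ψp σ, ψm σ), ⟨⟨σ, rfl⟩, ⟨σ, rfl⟩⟩, (hϑ σ).symm⟩
  haveI : Finite U := hUfin.to_subtype
  haveI : Fintype U := Fintype.ofFinite U
  set N := Nat.card U with hN_def
  have hN : 0 < N := Nat.card_pos
  have hℓN : ¬ ℓ ∣ N := by
    intro hdiv
    rw [hN_def, Nat.card_eq_fintype_card] at hdiv
    obtain ⟨u, hu⟩ := exists_prime_orderOf_dvd_card ℓ hdiv
    have hu1 : ((u : (AlgebraicClosure (ZMod ℓ))ˣ) : AlgebraicClosure (ZMod ℓ)) ^ ℓ = 1 := by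
      have h := pow_orderOf_eq_one u
      rw [hu] at h
      have h' := congrArg (fun w : U ↦ ((w : (AlgebraicClosure (ZMod ℓ))ˣ) : AlgebraicClosure (ZMod
          ℓ))) h
      simp only [Subgroup.coe_pow, Units.val_pow_eq_pow_val, Subgroup.coe_one, Units.val_one] at h'
      exact h'
    have hu2 : ((u : (AlgebraicClosure (ZMod ℓ))ˣ) : AlgebraicClosure (ZMod ℓ)) = 1 := by
      have h : (((u : (AlgebraicClosure (ZMod ℓ))ˣ) : AlgebraicClosure (ZMod ℓ)) - 1) ^ ℓ =
          ((u : (AlgebraicClosure (ZMod ℓ))ˣ) : AlgebraicClosure (ZMod ℓ)) ^ ℓ - 1 ^ ℓ :=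
        sub_pow_expChar_of_commute _ (Commute.one_right _)
      rw [hu1, one_pow, sub_self, pow_eq_zero_iff hprime.ne_zero, sub_eq_zero] at h
      exact h
    have hu3 : u = 1 := Subtype.ext (Units.ext hu2)
    rw [hu3, orderOf_one] at hu
    exact hprime.one_lt.ne hu
  obtain ⟨g, hg⟩ := IsCyclic.exists_ofOrder_eq_natCard (α := U)
  obtain ⟨σ₀, hσ₀⟩ := g.2
  set ζ : AlgebraicClosure (ZMod ℓ) := ((g : (AlgebraicClosure (ZMod ℓ))ˣ) : AlgebraicClosure (ZMod
      ℓ))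
    with hζ_def
  have hζord : orderOf ζ = N := by rw [hζ_def, orderOf_units, Subgroup.orderOf_coe, hg]
  have hζval : ζ = ψp σ₀ * (ψm σ₀)⁻¹ := by rw [hζ_def, ← hσ₀]; rfl
  -- (1) `φ(N) ≤ r`: `ζ` is an eigenvalue of the finite-order integer matrix `c σ₀`
  have htot : Nat.totient N ≤ r := by
    rw [← hζord]
    refine totient_orderOf_le hm0 (c σ₀) (hcm σ₀) hmF hy ?_
    have h := heig σ₀ (hker σ₀)
    rw [hζval, mul_comm, mul_smul, ← h, inv_smul_smul₀ (hψ0 σ₀ (hker σ₀)).2]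
  -- (2) `ℓ ≤ 12 N + 1`: all `((a + d)/(a - d))^{12}` lie in `U`, of exponent `N`
  have hbound : ℓ ≤ 12 * N + 1 := by
    refine prime_le_of_forall_pow_eq h3 hD hd hN hℓN fun a ha ↦ ?_
    obtain ⟨σ, hσ1, hp, hm⟩ := hcartan a 1 (by rwa [one_pow, mul_one, sub_ne_zero])
    rw [map_one, one_mul] at hp hm
    have hu' : (ψp σ * (ψm σ)⁻¹) ^ N = 1 := by
      have h := pow_card_eq_one' (G := U) (x := ⟨ϑ ⟨σ, hσ1⟩, ⟨σ, hσ1⟩, rfl⟩)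
      have h' := congrArg (fun w : U ↦ ((w : (AlgebraicClosure (ZMod ℓ))ˣ) : AlgebraicClosure (ZMod
          ℓ))) h
      simp only [Subgroup.coe_pow, Units.val_pow_eq_pow_val, Subgroup.coe_one, Units.val_one] at h'
      exact h'
    have hmd : ι a - d ≠ 0 := fun h0 ↦ (hψ0 σ hσ1).2 (by rw [hm, h0, zero_pow (by norm_num)])
    rw [hp, hm, mul_pow, inv_pow, ← pow_mul, ← pow_mul, mul_inv_eq_one₀ (pow_ne_zero _ hmd)] at hu'
    exact hu'
  -- (3) combine with `N ≤ 2 φ(N)²`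
  have h2 := le_two_mul_totient_sq N
  nlinarith [htot, Nat.zero_le (Nat.totient N)]

/-! ## The dichotomy (registered sub-goal of the stub) -/


end CMTorsion

/-- **The dichotomy of the CM torsion core.** On the FACT-2 plane `V` (`ℓ > 3`), an injective
additive `j : V → V^r`, equivariant for `ker χ` acting on `V^r` through `c(σ) ⊗ σ` with integer
matrices `c(σ)` of finite order prime to `ℓ`, yields either a non-zero vector of `𝔽_ℓ^r` fixed by
all `c̄(σ)`, `σ ∈ ker χ`, or the bound `ℓ ≤ 24 r² + 1` (`matrices_of_module`,
`eigen_data_of_matrices`, `exists_fixed_of_fixed`, `le_of_eigen_character`). [folklore] -/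
theorem fixed_or_le {Γ V : Type} [Group Γ] [AddCommGroup V]
    [DistribMulAction Γ V] {ℓ : ℕ} [Fact ℓ.Prime] [Module (ZMod ℓ) V]
    (h3 : 3 < ℓ) (hcard : Nat.card V = ℓ ^ 2)
    (φ : AddMonoid.End V) (D : ℤ) (χ : Γ →* ℤˣ)
    (hφφ : ∀ v, φ (φ v) = D • v) (hD : ¬ (ℓ : ℤ) ∣ D) (hns : ∀ c : ℤ, ∃ v, φ v ≠ c • v)
    (hsemi : ∀ (σ : Γ) (v : V), φ (σ • v) = ((χ σ : ℤˣ) : ℤ) • σ • φ v)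
    (hbig : ∀ a b : ℤ, ¬ (ℓ : ℤ) ∣ a ^ 2 - D * b ^ 2 → ∃ σ : Γ, χ σ = 1 ∧ ∀ v : V,
      σ • v = (((a : AddMonoid.End V) + (b : AddMonoid.End V) * φ) ^ 12) v)
    {r : ℕ} (c : Γ → Matrix (Fin r) (Fin r) ℤ)
    (hcm : ∃ m : ℕ, 0 < m ∧ ¬ ℓ ∣ m ∧ ∀ σ, c σ ^ m = 1)
    (j : V →+ (Fin r → V)) (hj : Function.Injective j)
    (hjσ : ∀ σ : Γ, χ σ = 1 → ∀ v : V, j (σ • v) = fun k ↦ ∑ i, c σ k i • σ • j v i) :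
    (∃ x : Fin r → ZMod ℓ, x ≠ 0 ∧
      ∀ σ : Γ, χ σ = 1 → ((c σ).map (Int.cast : ℤ → ZMod ℓ)) *ᵥ x = x) ∨
    ℓ ≤ 24 * r ^ 2 + 1 := by
  classical
  have hℓ2 : ℓ ≠ 2 := by omega
  have hDmod : ((D : ℤ) : ZMod ℓ) ≠ 0 := fun h ↦ hD ((ZMod.intCast_zmod_eq_zero_iff_dvd D ℓ).1 h)
  obtain ⟨Φ, Sm, JM, LM, h1, h2, h3', h4, h5, h6, h7, h8⟩ :=
    CMTorsion.matrices_of_module hcard φ D χ hφφ hns hsemi hbig c j hj hjσ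
  set cbar : Γ → Matrix (Fin r) (Fin r) (ZMod ℓ) := fun σ ↦ (c σ).map (Int.cast : ℤ → ZMod
      ℓ) with hcbar
  have h6' : ∀ σ, χ σ = 1 → ∀ k, JM k * Sm σ = ∑ i, cbar σ k i • (Sm σ * JM i) :=
    fun σ hσ k ↦ h6 σ hσ k
  have hval : ∀ a : ZMod ℓ, (((a.val : ℕ) : ℤ) : ZMod ℓ) = a := fun a ↦ by
    rw [Int.cast_natCast, ZMod.natCast_zmod_val]
  have h8' : ∀ a b : ZMod ℓ, a ^ 2 - ((D : ℤ) : ZMod ℓ) * b ^ 2 ≠ 0 → ∃ σ : Γ, χ σ = 1 ∧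
      Sm σ = (a • (1 : Matrix (Fin 2) (Fin 2) (ZMod ℓ)) + b • Φ) ^ 12 := by
    intro a b hab
    obtain ⟨σ, hσ1, hσ⟩ := h8 ((a.val : ℕ) : ℤ) ((b.val : ℕ) : ℤ) (by
      intro hdvd
      apply hab
      have h := (ZMod.intCast_zmod_eq_zero_iff_dvd _ ℓ).2 hdvd
      push_cast [hval] at h
      linear_combination h)
    refine ⟨σ, hσ1, ?_⟩
    rw [hσ, hval, hval]
  obtain ⟨d, ψp, ψm, x, y, hd, hxy, hfix, hmul, hfinp, hfinm, hcartan⟩ :=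
    eigen_data_of_matrices hℓ2 χ hDmod cbar Φ Sm JM LM h1 h2 h3' h4 h5 h6' h7 h8'
  rcases hxy with hx | hy
  · left
    obtain ⟨x', hx', hfix'⟩ := CMTorsion.exists_fixed_of_fixed (fun σ ↦ χ σ = 1) cbar x hx
      (fun σ hσ ↦ (hfix σ hσ).2.2.1)
    exact ⟨x', hx', hfix'⟩
  · right
    refine CMTorsion.le_of_eigen_character h3 χ hDmod c hcm d ψp ψm y hd hy
      (fun σ hσ ↦ ⟨(hfix σ hσ).1, (hfix σ hσ).2.1⟩) (fun σ hσ ↦ ?_) hmul hfinp hfinm hcartan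
    have hc : (c σ).map (Int.castRingHom (AlgebraicClosure (ZMod ℓ))) =
        (cbar σ).map (algebraMap (ZMod ℓ) (AlgebraicClosure (ZMod ℓ))) := by
      ext i k
      simp [hcbar, Matrix.map_apply]
    rw [hc]
    exact (hfix σ hσ).2.2.2

end Summit.ABC.ABC.Theorems.IsotypicMinkowski

end
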